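import Summits.AnomalousDissipation.AnomalousDissipation.Theses.SteadyWeakLimit
import Summits.AnomalousDissipation.AnomalousDissipation.Theorems.CoherentStatesSteadyNegTameOffThinSets
import HarnessLib

/-!
# Route SteadyWeakLimit — the support `GlueSteadyZerothLaw`

Proof of the route declaration
`Summit.AnomalousDissipation.AnomalousDissipation.Theses.SteadyWeakLimit.GlueSteadyZerothLaw`
(item stmt-AnomalousDissipation-1310): the steady weak realisation `SteadyWeakRealisation`
(thesis X of the route) implies the steady zeroth law in the verbatim form of CoherentStates'
crux `SteadyZerothLaw` (item stmt-AnomalousDissipation-0219), recording the ledger edge X ⇒ 0219.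

The argument is pure bookkeeping (Temam 1979, Ch. II (1.21)–(1.22); Constantin–Tarfulea–Vicol
2013, §2):

* for a STEADY classical state the energy budget is exact, `ν_j ‖∇u_j‖₂² = ∫ ⟪f, u_j⟫`
  (the landed `Theorems.CoherentStates.steady_energy_identity`: the kinetic energy of the
  constant path `t ↦ u_j` has derivative `0 = -ν_j ‖∇u_j‖₂² + ∫ ⟪f, u_j⟫` by the discharged fact
  `Torus.IsClassicalNSSolutionOn.energy_balance_holds` on the convex time set `univ`);
* the weak-convergence hypothesis tested with the smooth field `w := f` gives
  `∫ ⟪f, u_j⟫ → c := ∫ ⟪f, v⟫ > 0`, hence `ν_j ‖∇u_j‖₂² ≥ c / 2` for all `j ≥ J`;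
* re-index the family by `j ↦ j + J` (`Filter.tendsto_add_atTop_nat`).
-/

namespace Summit.AnomalousDissipation.AnomalousDissipation.Theorems

-- the mandated namespace `Summit.<Summit>.<Problem>.Theorems` repeats `AnomalousDissipation` (single-problem summit)
set_option linter.dupNamespace false

open MeasureTheory Filter Set Topology
open scoped InnerProductSpace
open Literature.Analysis.FunctionSpaces
open Summit.AnomalousDissipation.AnomalousDissipation.Theses.SteadyWeakLimit
open Summit.AnomalousDissipation.AnomalousDissipation.Theorems.CoherentStates (steady_energy_identity)

/-- **Glue X ⇒ SteadyZerothLaw.** The steady weak realisation `SteadyWeakRealisation` implies the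
steady zeroth law in the verbatim form of CoherentStates' item stmt-AnomalousDissipation-0219:
along the given steady family the dissipation `ν_j ‖∇u_j‖₂² = ∫ ⟪f, u_j⟫`
(`CoherentStates.steady_energy_identity`) converges to `∫ ⟪f, v⟫ > 0` by the weak-convergence
hypothesis at `w := f`, so it is eventually `≥ ∫ ⟪f, v⟫ / 2`; shifting the index by the
threshold `J` gives a family with a uniform positive dissipation floor.
Closes item stmt-AnomalousDissipation-1310. -/
theorem glueSteadyZerothLaw_proof :
    Summit.AnomalousDissipation.AnomalousDissipation.Theses.SteadyWeakLimit.GlueSteadyZerothLaw := by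
  unfold GlueSteadyZerothLaw SteadyWeakRealisation
  rintro ⟨f, hf, hdiv, hmean, ν, u, p, v, hν, hν0, hsol, ⟨E, hE⟩, _hv2, hweak, hpos⟩
  -- the dissipation equals the injected power, which converges to `c := ∫ ⟪f, v⟫ > 0`
  have hid : ∀ j, ν j * Torus.gradNormSq (u j) = ∫ x, ⟪f x, u j x⟫_ℝ :=
    fun j => steady_energy_identity (hsol j)
  have htend : Tendsto (fun j => ν j * Torus.gradNormSq (u j)) atTop
      (nhds (∫ x, ⟪f x, v x⟫_ℝ)) := by
    refine (hweak f hf).congr fun j => ?_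
    exact (hid j).symm
  have hev : ∀ᶠ j in atTop, (∫ x, ⟪f x, v x⟫_ℝ) / 2 ≤ ν j * Torus.gradNormSq (u j) :=
    htend.eventually (eventually_ge_nhds (by linarith))
  obtain ⟨J, hJ⟩ := eventually_atTop.1 hev
  -- shift the family by `J`
  refine ⟨f, hf, hdiv, hmean, fun j => ν (j + J), fun j => u (j + J), fun j => p (j + J),
    fun j => hν (j + J), hν0.comp (tendsto_add_atTop_nat J), fun j => hsol (j + J),
    ⟨E, fun j => hE (j + J)⟩, (∫ x, ⟪f x, v x⟫_ℝ) / 2, by linarith, fun j => ?_⟩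
  exact hJ (j + J) (Nat.le_add_left J j)

end Summit.AnomalousDissipation.AnomalousDissipation.Theorems
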